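import Mathlib
import Literature.Geometry.DiscreteGeometry.ShellCensusReplayLPText

/-!
# Crux `GappedShellCensus.FiveFoldRationingR` (stmt-AtomisticToContinuum-18071), line `Sketch` — certificate glue

Generic chaining lemmas for certificates shipped in several parts (each part checked by `LCensus.checkFrom` against the
ARRAY of constraint lists established by the earlier parts, so that no statement ever repeats a certificate text):
`ffrCert_ctx_extend` (established context + checked part ⇒ extended context), `ffrCert_ctx_nil`,
`ffrCert_infeasible_of_ctx` (a context entry is an infeasibility statement when the pattern list is empty).
-/

namespace Summit.AtomisticToContinuum.Crystallization.Theorems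
open Literature.Geometry.DiscreteGeometry Literature.Geometry.DiscreteGeometry.ShellCensus

/-- **Chaining step.** An established context plus a census part that checks against it give the extended context
(the old lists followed by the part's lists). [folklore] -/
theorem ffrCert_ctx_extend {P : Spec} (Q : P.Patterns) {dmin dmax : ℕ} {f : Option (ℕ × ℕ × ℕ)} (hP : P.okB = true)
    (ctx : Array (List Constraint)) (C : LCensus)
    (hctx : ∀ (j : ℕ) (hj : j < ctx.size), P.EClaim Q dmin dmax f ctx[j])
    (h : LCensus.checkFrom P dmin dmax f ctx C = true)
    (ctx' : Array (List Constraint)) (hE : ctx' = ctx ++ (C.map Prod.fst).toArray) :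
    ∀ (j : ℕ) (hj : j < ctx'.size), P.EClaim Q dmin dmax f ctx'[j] := by
  subst hE
  intro j hj
  have hall := LCensus.checkFrom_sound Q hP C ctx hctx h
  by_cases hlt : j < ctx.size
  · rw [Array.getElem_append_left hlt]
    exact hctx j hlt
  · push Not at hlt
    have hj' : j - ctx.size < (C.map Prod.fst).toArray.size := by
      rw [Array.size_append] at hj
      omega
    rw [Array.getElem_append_right hlt]
    have hmem : (List.map Prod.fst C).toArray[j - ctx.size] ∈ List.map Prod.fst C := by
      rw [List.getElem_toArray]
      exact List.getElem_mem _
    obtain ⟨e, he, hee⟩ := List.mem_map.1 hmem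
    rw [← hee]
    exact hall e he

/-- The empty context is established. [folklore] -/
theorem ffrCert_ctx_nil {P : Spec} (Q : P.Patterns) {dmin dmax : ℕ} {f : Option (ℕ × ℕ × ℕ)} :
    ∀ (j : ℕ) (hj : j < (#[] : Array (List Constraint)).size), P.EClaim Q dmin dmax f (#[] : Array (List Constraint))[j] :=
  fun j hj => absurd hj (by simp)

/-- **Reading an infeasibility statement off an established context** (no patterns). [folklore] -/
theorem ffrCert_infeasible_of_ctx {P : Spec} (hA : P.anchors = []) {dmin dmax : ℕ} {f : Option (ℕ × ℕ × ℕ)}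
    (ctx : Array (List Constraint)) (hctx : ∀ (j : ℕ) (hj : j < ctx.size), P.EClaim (P.emptyPatterns hA) dmin dmax f ctx[j])
    (S : List Constraint) (j : ℕ) (hj : j < ctx.size) (hS : ctx[j] = S) :
    ∀ t : Fin P.n → EuclideanSpace ℝ (Fin 3), P.Admissible t → P.DegOK dmin dmax t → P.FacetLE f t → P.Sat S t → False := by
  have h := hctx j hj
  rw [hS] at h
  exact Spec.EClaim.elim_nil hA h

end Summit.AtomisticToContinuum.Crystallization.Theorems
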